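import Mathlib.RingTheory.Ideal.Maps
import Mathlib.RingTheory.Ideal.Operations
import Mathlib.Algebra.BigOperators.Group.Finset.Basic
import HarnessLib

/-!
# Crux `FrobeniusLadder.FRationalResolution` (stmt-ResolutionOfSingularities-15317), line `redirect`,
# stub `stub_diagonalizableQuotientResolution` — TRACE IDEALS ARE EQUIVARIANT, AND FINITE AUTOMORPHISM-STABLE FAMILIES OF
# IDEALS HAVE CHARACTERISTIC PRODUCTS (the formal skeleton of item (α)/(Q1) of MEMO-15317-leafhand2-g16 §2(a)–§3:
# «`𝔞_tot = ∏_{w ≠ 0} τ(w)` is invariant under ALL ring automorphisms»)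

The Galois-route interface `…GaloisCharacteristicCentre.hloc_of_characteristic_ideal_adicCompletion` (p838347) and its two-step
form `…CharacteristicTower.hloc_of_characteristic_tower_adicCompletion` (this generation) consume an ideal `J` of the complete
local ring with `θ(J) ⊆ J` for EVERY ring automorphism `θ`. The intended `J` is a product of TRACE IDEALS
`τ(I) = Σ_{φ ∈ Hom_A(I, A)} φ(I)` of divisorial ideals `I`. This file proves, def-free and for an arbitrary commutative ring,
the two formal ingredients of «intrinsic ⇒ characteristic»:

* `exists_linearMap_transport` / `map_traceIdeal_le` / ★ `map_traceIdeal_eq` — **trace ideals are equivariant**: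
  `θ(τ(I)) = τ(θ(I))` for every ring automorphism `θ` (transport of linear functionals `φ ↦ θ ∘ φ ∘ θ⁻¹`); here `τ(I)` is
  written inline as `⨆ φ : I →ₗ[A] A, range φ`;
* `map_injective_of_ringEquiv`, ★ `map_prod_eq_of_forall_map_mem` — a FINITE family of ideals mapped into itself by `θ` is
  permuted by `θ`, so its product is fixed by `θ`;
* ★★ `map_prod_traceIdeal_eq` — for any property `P` of ideals transported by ring automorphisms (e.g. «reflexive of rank one»,
  «divisorial») whose trace ideals form a finite set `𝒯_P`, the product `∏_{T ∈ 𝒯_P} T` is fixed by every ring automorphism —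
  the shape of `𝔞_tot` (with `P` = divisorial and `𝒯_P = {τ(w) : w ∈ Cl(A)}` finite), ready for the `hchar` slot of p838347.

What is NOT here: the finiteness of `𝒯_P` and its identification with explicit monomial ideals for the toric germ `F[[P]]`
(the class-group computation, MEMO §3 (α) proper), and the regularity of the blow-up ((β)).
Honest label: general commutative algebra toward ONE leaf stub (no stub, crux or summit closed). No definitions, no named facts,
no sorry. [folklore; cite: Matsumura1987, §7 (Hom and base change)] [cite: StacksProject, Tag 0AUU]
-/

-- single-problem summit: the doubled namespace component is forced
set_option linter.dupNamespace false

namespace Summit.ResolutionOfSingularities.ResolutionOfSingularities.Theorems.FRationalResolution.TraceIdealCharacteristic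

universe u

open scoped BigOperators

/-! ## §1 Trace ideals are equivariant under ring automorphisms -/

/-- **Transport of a linear functional along a ring isomorphism**: for `θ : A ≃+* B`, an ideal `I ⊆ A` and `φ : I →ₗ[A] A`
there is `ψ : θ(I) →ₗ[B] B` with `ψ(θ x) = θ(φ x)` (namely `ψ = θ ∘ φ ∘ θ⁻¹`). [folklore] -/
theorem exists_linearMap_transport {A B : Type u} [CommRing A] [CommRing B] (θ : A ≃+* B) (I : Ideal A)
    (φ : I →ₗ[A] A) :
    ∃ ψ : ↥(I.map θ) →ₗ[B] B, ∀ x : I, ψ ⟨θ x, Ideal.mem_map_of_mem θ x.2⟩ = θ (φ x) := by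
  refine ⟨{ toFun := fun y => θ (φ ⟨θ.symm y, Ideal.symm_apply_mem_of_equiv_iff.mpr y.2⟩)
            map_add' := fun y z => ?_
            map_smul' := fun b y => ?_ }, fun x => ?_⟩
  · have h : (⟨θ.symm ((y + z : ↥(I.map θ)) : B), Ideal.symm_apply_mem_of_equiv_iff.mpr (y + z).2⟩ : I) =
        ⟨θ.symm y, Ideal.symm_apply_mem_of_equiv_iff.mpr y.2⟩ + ⟨θ.symm z, Ideal.symm_apply_mem_of_equiv_iff.mpr z.2⟩ := by
      ext
      simp
    rw [h, map_add, map_add]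
  · have h : (⟨θ.symm ((b • y : ↥(I.map θ)) : B), Ideal.symm_apply_mem_of_equiv_iff.mpr (b • y).2⟩ : I) =
        θ.symm b • ⟨θ.symm y, Ideal.symm_apply_mem_of_equiv_iff.mpr y.2⟩ := by
      ext
      simp [smul_eq_mul]
    rw [h, LinearMap.map_smul, smul_eq_mul, map_mul, RingEquiv.apply_symm_apply, RingHom.id_apply, smul_eq_mul]
  · simp only [LinearMap.coe_mk, AddHom.coe_mk]
    congr 2
    ext
    simp

/-- **`θ(τ(I)) ⊆ τ(θ(I))`** for the trace ideal `τ(I) = Σ_φ φ(I)`. [folklore] -/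
theorem map_traceIdeal_le {A B : Type u} [CommRing A] [CommRing B] (θ : A ≃+* B) (I : Ideal A) :
    (⨆ φ : I →ₗ[A] A, LinearMap.range φ : Ideal A).map θ ≤ ⨆ ψ : ↥(I.map θ) →ₗ[B] B, LinearMap.range ψ := by
  rw [Ideal.map_iSup]
  refine iSup_le fun φ => ?_
  obtain ⟨ψ, hψ⟩ := exists_linearMap_transport θ I φ
  refine le_trans ?_ (le_iSup _ ψ)
  rw [Ideal.map_le_iff_le_comap]
  rintro _ ⟨x, rfl⟩
  rw [Ideal.mem_comap]
  exact ⟨⟨θ x, Ideal.mem_map_of_mem θ x.2⟩, hψ x⟩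

/-- `θ⁻¹(θ(I)) = I` for a ring isomorphism. [folklore] -/
theorem map_map_symm {A B : Type u} [CommRing A] [CommRing B] (θ : A ≃+* B) (I : Ideal A) :
    (I.map θ).map θ.symm = I := by
  rw [Ideal.map_symm, ← Ideal.comap_symm]
  ext x
  simp [Ideal.mem_comap]

/-- `θ(θ⁻¹(J)) = J` for a ring isomorphism. [folklore] -/
theorem map_symm_map {A B : Type u} [CommRing A] [CommRing B] (θ : A ≃+* B) (J : Ideal B) :
    (J.map θ.symm).map θ = J := by
  have h := map_map_symm θ.symm J
  rwa [RingEquiv.symm_symm] at h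

/-- ★ **Trace ideals are equivariant**: `θ(τ(I)) = τ(θ(I))` for every ring isomorphism `θ`. [folklore] -/
theorem map_traceIdeal_eq {A B : Type u} [CommRing A] [CommRing B] (θ : A ≃+* B) (I : Ideal A) :
    (⨆ φ : I →ₗ[A] A, LinearMap.range φ : Ideal A).map θ = ⨆ ψ : ↥(I.map θ) →ₗ[B] B, LinearMap.range ψ := by
  refine le_antisymm (map_traceIdeal_le θ I) ?_
  -- apply the inclusion to `θ⁻¹` and `θ(I)`, then map forward by `θ`
  have h := map_traceIdeal_le θ.symm (I.map θ)
  have hI : (I.map θ).map θ.symm = I := map_map_symm θ I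
  -- rewrite the index type `↥((I.map θ).map θ.symm)` to `↥I`
  have h' : (⨆ ψ : ↥(I.map θ) →ₗ[B] B, LinearMap.range ψ : Ideal B).map θ.symm ≤ ⨆ φ : I →ₗ[A] A, LinearMap.range φ := by
    refine le_trans h (le_of_eq ?_)
    clear h
    revert hI
    generalize (I.map θ).map θ.symm = I'
    rintro rfl
    rfl
  have h'' := Ideal.map_mono (f := θ) h'
  rwa [map_symm_map] at h''

/-! ## §2 Finite automorphism-stable families have characteristic products -/

/-- `Ideal.map` along a ring isomorphism is injective. [folklore] -/
theorem map_injective_of_ringEquiv {A B : Type u} [CommRing A] [CommRing B] (θ : A ≃+* B) :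
    Function.Injective (Ideal.map θ : Ideal A → Ideal B) := by
  intro I I' h
  have h' : I.comap θ.symm = I'.comap θ.symm := by rwa [Ideal.comap_symm, Ideal.comap_symm]
  exact Ideal.comap_injective_of_surjective _ θ.symm.surjective h'

/-- ★ **A finite family of ideals mapped into itself by a ring automorphism has its product FIXED by it**: `θ` permutes the
family (injective self-map of a finite set), and `θ(∏ T) = ∏ θ(T)`. [folklore] -/
theorem map_prod_eq_of_forall_map_mem {A : Type u} [CommRing A] (𝒯 : Finset (Ideal A)) (θ : A ≃+* A)
    (h : ∀ T ∈ 𝒯, T.map θ ∈ 𝒯) : (∏ T ∈ 𝒯, T).map θ = ∏ T ∈ 𝒯, T := by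
  classical
  have hinj : Set.InjOn (Ideal.map θ : Ideal A → Ideal A) 𝒯 := (map_injective_of_ringEquiv θ).injOn
  have himage : 𝒯.image (Ideal.map θ) = 𝒯 := by
    refine Finset.eq_of_subset_of_card_le (fun T hT => ?_) (le_of_eq (Finset.card_image_of_injOn hinj).symm)
    obtain ⟨T', hT', rfl⟩ := Finset.mem_image.mp hT
    exact h T' hT'
  calc (∏ T ∈ 𝒯, T).map θ = ∏ T ∈ 𝒯, T.map θ := map_prod (Ideal.mapHom (θ : A →+* A)) _ _
    _ = ∏ T ∈ 𝒯.image (Ideal.map θ), T := by rw [Finset.prod_image hinj]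
    _ = ∏ T ∈ 𝒯, T := by rw [himage]

/-- The same for every automorphism at once: a finite family stable under ALL ring automorphisms has a CHARACTERISTIC product
(the `hchar` slot of `…GaloisCharacteristicCentre.hloc_of_characteristic_ideal_adicCompletion`). [folklore] -/
theorem forall_map_prod_le_of_forall_map_mem {A : Type u} [CommRing A] (𝒯 : Finset (Ideal A))
    (h : ∀ (θ : A ≃+* A), ∀ T ∈ 𝒯, T.map θ ∈ 𝒯) : ∀ θ : A ≃+* A, (∏ T ∈ 𝒯, T).map θ ≤ ∏ T ∈ 𝒯, T :=
  fun θ => (map_prod_eq_of_forall_map_mem 𝒯 θ (h θ)).le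

/-! ## §3 Products of trace ideals over an automorphism-invariant class are characteristic -/

/-- ★★ **`∏_{T ∈ 𝒯_P} T` is characteristic**, where `𝒯_P = {τ(I) : P(I)}` is the (finite) set of trace ideals of the ideals with
an automorphism-invariant property `P` (e.g. `P` = «divisorial», `𝒯_P = {τ(w) : w ∈ Cl(A)}`: the ideal `𝔞_tot` of
MEMO-15317-leafhand2-g16 §2(a), up to the harmless factor `τ(0) = A`). [folklore] -/
theorem map_prod_traceIdeal_eq {A : Type u} [CommRing A] (P : Ideal A → Prop)
    (hP : ∀ (θ : A ≃+* A) (I : Ideal A), P I → P (I.map θ))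
    (hfin : Set.Finite {T : Ideal A | ∃ I : Ideal A, P I ∧ T = ⨆ φ : I →ₗ[A] A, LinearMap.range φ})
    (θ : A ≃+* A) :
    (∏ T ∈ hfin.toFinset, T).map θ = ∏ T ∈ hfin.toFinset, T := by
  refine map_prod_eq_of_forall_map_mem _ θ fun T hT => ?_
  rw [Set.Finite.mem_toFinset] at hT ⊢
  obtain ⟨I, hI, rfl⟩ := hT
  exact ⟨I.map θ, hP θ I hI, map_traceIdeal_eq θ I⟩

/-- The `hchar`-shaped corollary: every ring automorphism maps `∏_{T ∈ 𝒯_P} T` into itself. [folklore] -/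
theorem forall_map_prod_traceIdeal_le {A : Type u} [CommRing A] (P : Ideal A → Prop)
    (hP : ∀ (θ : A ≃+* A) (I : Ideal A), P I → P (I.map θ))
    (hfin : Set.Finite {T : Ideal A | ∃ I : Ideal A, P I ∧ T = ⨆ φ : I →ₗ[A] A, LinearMap.range φ}) :
    ∀ θ : A ≃+* A, (∏ T ∈ hfin.toFinset, T).map θ ≤ ∏ T ∈ hfin.toFinset, T :=
  fun θ => (map_prod_traceIdeal_eq P hP hfin θ).le

end Summit.ResolutionOfSingularities.ResolutionOfSingularities.Theorems.FRationalResolution.TraceIdealCharacteristic
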